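import Mathlib
import HarnessLib
import HarnessLib.Audit
import Summits.ValiantsHypothesis.Statement
import Literature.NumberTheory.DiophantineGeometry.PowerTraceStabilizer
import Literature.NumberTheory.DiophantineGeometry.SchurWeylPlethysm
import Literature.Computability.AlgebraicComplexity.ValiantConjectureProofs

/-!
Route: GeneratorObstructions

CLOSED (refuted) 2026-09-03T21:57:38Z by gate — reason: refuted:stmt-ValiantsHypothesis-11655 (PowGenDegreeQP) by Summit.ValiantsHypothesis.ValiantsHypothesis.Theorems.GeneratorObstructions.PowGenDegreeQP.not_PowGenDegreeQP — note: repair grace of 72.0 h (deadline 2026-09-03T21:56:14Z) expired without a repair — closed by the gate. The file is kept as the record of this route; refuted decls are indexed as negative knowledge (`ledger negatives`).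

# Route GeneratorObstructions — generator obstructions — 𝔪/𝔪² of the covariant algebra ℂ[Δ]^U
separates per_m from tr X^m by degree overflow

It suffices to show X = GenFlipThesis (card generator-obstructions-covariant-algebra, which absorbed
second-order-multiplicities): work in the
HOMOGENEOUS (unpadded) GCT setting per_m versus Pow^m_n = tr X^m, both degree-m forms in the n²
lex-ordered matrix variables MatIdx n, n = m + e
(GesmundoIkenmeyerPanova2017 §2.2; Lean: per_m on the top-left block = `MvPolynomial.rename (fun ij
=> toLex (Fin.castAdd e ij.1, Fin.castAdd e ij.2))
(perPoly (Fin m) ℂ)`, literally the permanent, and tr X^m =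
`Literature.NumberTheory.DiophantineGeometry.powFormLex ℂ (m + e) m`; these are the barrier
catalogue's `Literature.Barriers.PneNP.blockPerFormLex m n` (up to a permutation matrix in GL_(n²):
same orbit closure) and `powTraceFormLex n m`
(`powTraceFormLex_eq_powFormLex`), spelled over the characteristic-free tree vocabulary). For a form
f let A(f) = ⊕_χ HWV_χ(ℂ[Δ_m(f)]) be the algebra of
highest-weight vectors (= U-invariants) of the coordinate ring of its orbit closure and γ_χ(f) :=
dim HWV_χ / (HWV_χ ∩ Σ_(χ₁+χ₂=χ, χᵢ≠0) HWV_χ₁·HWV_χ₂)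
= dim (𝔪_A/𝔪_A²)_χ the number of minimal generators of type χ. X: for every c and infinitely many m,
at EVERY matrix size n with
m ≤ n ≤ 2^((log₂ m + c)^c) (n = m + e) some weight χ of GL_(n²) has γ_χ(tr X^m) < γ_χ(per_m) (a
GENERATOR OBSTRUCTION). By the generator-obstruction
principle (support GenPrinciple: g ∈ Δ(f) ⇒ γ_χ(g) ≤ γ_χ(f), from the proved hw-vector lifting) X
gives per_m ∉ closure(GL_(n²)·tr X^m) throughout
the quasi-polynomial window, hence pc(per_m) is not qp-bounded, hence per ∉ VP, hence VP_ℂ ≠ VNP_ℂ.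
Internally X ⇐ K1 ∧ K2 ∧ inheritance
(support CruxesToThesis, pure logic, proved in Sketch.lean): K1 = PerGenDegreeSuperQP (per's
covariant algebra keeps acquiring generators beyond
every quasi-polynomial degree), K2 = PowGenDegreeQP (tr X^m's is generated in qp(m) degree inside
the window) — a DEGREE-OVERFLOW flip
γ_χ(tr X^m) = 0 < γ_χ(per_m) needing no positivity decision.
Lean: `∀ c m₀ : ℕ, ∃ m : ℕ, m₀ ≤ m ∧ 1 ≤ m ∧ ∀ e : ℕ, m + e ≤ 2 ^ ((Nat.log 2 m + c) ^ c) → ∃ χ :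
Literature.NumberTheory.DiophantineGeometry.Weight
(Literature.NumberTheory.DiophantineGeometry.MatIdx (m + e)), Module.finrank ℂ
(↥(Literature.NumberTheory.DiophantineGeometry.highestWeightSpace
(Literature.Computability.AlgebraicComplexity.orbitCoordRep
(Literature.NumberTheory.DiophantineGeometry.powFormLex ℂ (m + e) m) m) χ) ⧸ Submodule.comap
(Literature.NumberTheory.DiophantineGeometry.highestWeightSpace
(Literature.Computability.AlgebraicComplexity.orbitCoordRep
(Literature.NumberTheory.DiophantineGeometry.powFormLex ℂ (m + e) m) m) χ).subtype (⨆ p :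
Literature.NumberTheory.DiophantineGeometry.Weight
(Literature.NumberTheory.DiophantineGeometry.MatIdx (m + e)) ×
Literature.NumberTheory.DiophantineGeometry.Weight
(Literature.NumberTheory.DiophantineGeometry.MatIdx (m + e)), ⨆ (_ : p.1 + p.2 = χ ∧ p.1 ≠ 0 ∧ p.2 ≠
0), Literature.NumberTheory.DiophantineGeometry.highestWeightSpace
(Literature.Computability.AlgebraicComplexity.orbitCoordRep
(Literature.NumberTheory.DiophantineGeometry.powFormLex ℂ (m + e) m) m) p.1 *
Literature.NumberTheory.DiophantineGeometry.highestWeightSpace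
(Literature.Computability.AlgebraicComplexity.orbitCoordRep
(Literature.NumberTheory.DiophantineGeometry.powFormLex ℂ (m + e) m) m) p.2)) < Module.finrank ℂ
(↥(Literature.NumberTheory.DiophantineGeometry.highestWeightSpace
(Literature.Computability.AlgebraicComplexity.orbitCoordRep (MvPolynomial.rename (fun ij : Fin m ×
Fin m => toLex (Fin.castAdd e ij.1, Fin.castAdd e ij.2))
(Literature.Computability.AlgebraicComplexity.perPoly (Fin m) ℂ)) m) χ) ⧸ Submodule.comap
(Literature.NumberTheory.DiophantineGeometry.highestWeightSpace
(Literature.Computability.AlgebraicComplexity.orbitCoordRep (MvPolynomial.rename (fun ij : Fin m ×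
Fin m => toLex (Fin.castAdd e ij.1, Fin.castAdd e ij.2))
(Literature.Computability.AlgebraicComplexity.perPoly (Fin m) ℂ)) m) χ).subtype (⨆ p :
Literature.NumberTheory.DiophantineGeometry.Weight
(Literature.NumberTheory.DiophantineGeometry.MatIdx (m + e)) ×
Literature.NumberTheory.DiophantineGeometry.Weight
(Literature.NumberTheory.DiophantineGeometry.MatIdx (m + e)), ⨆ (_ : p.1 + p.2 = χ ∧ p.1 ≠ 0 ∧ p.2 ≠
0), Literature.NumberTheory.DiophantineGeometry.highestWeightSpace
(Literature.Computability.AlgebraicComplexity.orbitCoordRep (MvPolynomial.rename (fun ij : Fin m ×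
Fin m => toLex (Fin.castAdd e ij.1, Fin.castAdd e ij.2))
(Literature.Computability.AlgebraicComplexity.perPoly (Fin m) ℂ)) m) p.1 *
Literature.NumberTheory.DiophantineGeometry.highestWeightSpace
(Literature.Computability.AlgebraicComplexity.orbitCoordRep (MvPolynomial.rename (fun ij : Fin m ×
Fin m => toLex (Fin.castAdd e ij.1, Fin.castAdd e ij.2))
(Literature.Computability.AlgebraicComplexity.perPoly (Fin m) ℂ)) m) p.2))`

## Assembly
Bookkeeping on PROVED cone facts, certified sorry-free (theorem `closes` in glue.lean / Sketch.lean,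
axioms propext/Classical.choice/Quot.sound):
suppose VP ℂ = VNP ℂ; then perFamily ℂ ∈ VP ℂ (perFamily_mem_VNP_holds) so (per_n) is a VP family
(mem_VP_ofFintype_iff_holds); PerPowTraceQP gives c and,
for every m ≥ 1, a trace-power representation of size n = m + e ≤ 2^((log₂ m + c)^c); GenFlipThesis
at constant c gives such an m ≥ 1 and, at that n,
a weight χ with γ_χ(tr X^m) < γ_χ(per_m); PowTraceMembership puts per_m in closure(GL_(n²)·tr X^m)
and GenPrinciple (degree m ≠ 0) gives
γ_χ(per_m) ≤ γ_χ(tr X^m) — contradiction. Hence VP ℂ ≠ VNP ℂ = `ValiantsHypothesis` (12 tactic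
lines, no arithmetic).

Rationale: WHY THIS LINE. Every representation-theoretic obstruction in print compares ℂ[Δ(det or tr X^m)]_d ↠
ℂ[Δ(per)]_d as GL-MODULES: occurrence (dead: BurgisserIkenmeyerPanovaJAMS2019 Thm 1.4 padded,
GesmundoIkenmeyerPanova2017 Thm 10 for orbit occurrence unpadded) and multiplicity (open; routes
GCTMult, IntegralGCT). All no-go proofs build occurring
weights as PRODUCTS of highest-weight vectors ("building blocks", Landsberg2017 §8.10; semigroup
property BLMW2011 §6.1), i.e. they live in 𝔪_A² and bound
only the decomposable part; the restriction map is an ALGEBRA surjection, so the augmentation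
filtration of A = ℂ[Δ]^U is monotone too and its first
graded piece γ = dim(𝔪_A/𝔪_A²)_χ — finitely supported for each variety (Hadziev–Grosshans finite
generation, Grosshans1997 Thm 9.4) — is a strictly finer,
componentwise-monotone refinement of every multiplicity that no product construction reaches.
Imported area: constructive invariant theory of reductive
groups — generation degrees, Grosshans principle and their exponential lower bounds via closed
orbits with torus-by-finite stabilisers (DerksenMakam2020
Lemma 1.3, Thm 1.5–1.7; BurgisserIkenmeyer2017 Cor. 2.9: per_m polystable) — used here as a
CONTAINMENT obstruction, which neither Derksen–Makam
(hardness of invariant rings of representations) nor DorflerIkenmeyerPanova2020 /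
IkenmeyerKandasamy2019 (multiplicity comparisons) do. New over the card:
the trace-side crux is restricted to the qp window (uniform-in-m generation bounds for closure(GL·tr
X^m) are exposed to Derksen–Makam-type exponential
lower bounds transported through subspace varieties of m-ics in n^(1/m)-many variables, whose
SL-invariants are exactly the rectangular-weight summand of A);
the whole chain X → VH is typed over existing declarations and certified sorry-free on proved cone
facts (perFamily_mem_VNP_holds, mem_VP_ofFintype_iff_holds).

RANKED CRUXES. #0 GenFlipThesis (target) — for every c and every m₀ there is m ≥ max(m₀,1) such that
for all n = m + e ≤ 2^((log₂ m + c)^c) some weight χ of GL_(n²) (lex Borel on MatIdx n) has γ_χ(tr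
X^m) < γ_χ(per_m), γ_χ(f) = finrank of HWV_χ(ℂ[Δ_m f]) modulo the span of products of highest-weight
vectors of complementary nonzero weights (card thesis GenTypeObstructionQP, in "for infinitely many
m" form). (why it might fail: no generator (or multiplicity) flip is known at any (m,n) with n ≥ m
in the per/trace family; a homogeneous no-go past n ≥ m^c₀ (NoGenFlipBeyondPoly, the γ-analogue of
GIP17 Thm 10 lifted to closures) kills it; the reach lemma forbids flips below degree n+1.)
[GesmundoIkenmeyerPanova2017, DerksenMakam2020, DorflerIkenmeyerPanova2020, arXiv:0907.2850]
#2 PerGenDegreeSuperQP (crux) — K1 (card K1): the generation degree μ(per_m) of B_m = A(closure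
GL_(m²)·per_m) (per_m in its own m² variables, `rename toLex (perPoly (Fin m) ℂ)`) is not
quasi-polynomially bounded: for every c and m₀ there are m ≥ m₀ and a weight χ of GL_(m²) with
γ_χ(per_m) ≠ 0 and degree −|χ|/m > 2^((log₂ m + c)^c). Proposed engine: B_m ↠ (⊕_λ V_λ*)^(H_per)
along per's closed SL-orbit (Grosshans/Derksen–Makam lifting; H_per = T^(2m−2)⋊(S_m×S_m⋊2) is
torus-by-finite) and indecomposable H_per-invariants of super-quasi-polynomial level. [difficulty:
open-problem] (why it might fail: per's row/column torus has bipartite unimodular weights (Birkhoff: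
magic squares generated in degree m), so the flag-algebra H_per-invariants may be generated in
poly(m) level and B_m in qp(m) degree — the card's own fastest refutation; no super-polynomial μ is
known for any explicit orbit closure.) [DerksenMakam2020, BurgisserIkenmeyer2017, Grosshans1997,
arXiv:0907.2850]
#3 PowGenDegreeQP (crux) — K2 in WINDOW form: for every c there is c₀ such that for all 1 ≤ m ≤ n =
m + e ≤ 2^((log₂ m + c)^c) every generator type χ of A(closure GL_(n²)·tr X^m) has degree −|χ|/m ≤
2^((log₂ m + c₀)^c₀) (the trace-power side is generated in quasi-polynomial degree throughout the qp
window). Restricted from the card's uniform K2 (all m ≤ n), which is exposed to exponential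
generation-degree lower bounds of subspace varieties of low-degree forms. [difficulty: open-problem]
(why it might fail: A(Z_(n,m)) surjects onto A(Y) for every GL-stable closed Y ⊆ Z (Chow variety,
closures of GL·(per_k·monomial) with k ≈ log n, subspace varieties): if any Y is generated only
beyond degree qp(m) — a U-invariant DerksenMakam2020 Thm 1.6 inside the window — K2 fails
trivially.) [DerksenMakam2020, GesmundoIkenmeyerPanova2017, Derksen2015, arXiv:1611.00827]
#4 GenBeatsMult (crux) — the new axis is genuinely finer SOMEWHERE in the per/trace-power family:
there are 3 ≤ m ≤ n = m + e and a weight χ of GL_(n²) with a generator flip γ_χ(tr X^m) < γ_χ(per_m)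
although the multiplicity of χ in ℂ[Δ(per_m)] is at most that in ℂ[Δ(tr X^m)] (no multiplicity
obstruction at χ). Decisive existence question; first cells (m,n) = (3,3), (3,4), (4,4), degrees n+1
… 2n by the reach lemma; the binary-form toy of the card (γ flip at (3, 3m−12) with equal
multiplicities) is the model. [difficulty: L] (why it might fail: per_3 ∉ closure(GL_9 tr X³) need
not be certified by ANY dimension datum of A (the card's honesty rider: x³y³ ∉ σ₃(v₆(P¹)) is
invisible to γ through degree 12); at (3,3) hwv spaces of Sym^d(Sym³ℂ⁹), d ≥ 4, must be computed
modulo products.) [DorflerIkenmeyerPanova2020, IkenmeyerKandasamy2019, arXiv:1901.04576,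
GesmundoIkenmeyerPanova2017]
#5 PolyWindowFlip (crux) — unconditional polynomial window (card K3): for infinitely many m, at
every n = m + e ≤ m³ there is a generator flip γ_χ(tr X^m) < γ_χ(per_m); with GenPrinciple and
PowTraceMembership this proves pc(per_m) > m³ infinitely often — the first superlinear lower bound
in the homogeneous GCT setting (GIP17 Thm 10 excludes orbit occurrence obstructions already for n ≥
m+2). [deps: GenBeatsMult] [difficulty: open-problem] (why it might fail: needs
highest-weight-vector spaces of closure(GL_(n²) tr X^m) modulo products in degrees > n (reach
lemma), beyond computation even for m = 3; and flips may exist only in the overflow regime of K1 ∧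
K2, not at polynomial n.) [GesmundoIkenmeyerPanova2017, arXiv:1611.00827, BlaeserIkenmeyer2025]
#9 GenPrinciple (support) — generator-obstruction principle (card P1a–b), provable now: over ℂ, for
forms in finitely many linearly ordered variables and m ≠ 0, g ∈ Δ(f) ⇒ γ_χ(g) ≤ γ_χ(f) for every
weight χ. Proof: restriction orbitCoordRestrict : ℂ[Δ_m f] ↠ ℂ[Δ_m g] is a GL-equivariant ALGEBRA
surjection; ℂ[Δ_m f] is completely reducible (isSemisimpleRepresentation_orbitCoordRep) so
highest-weight spaces surject (map_highestWeightSpace_eq_of_surjective,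
MultiplicityObstructionsProofs.lean); products of highest-weight vectors of weights χ₁, χ₂ are
highest-weight vectors of weight χ₁+χ₂ (ρ(g) is an algebra automorphism, weightChar multiplicative),
so the decomposable span maps INTO the decomposable span; quotients then surject and finrank is
monotone (finiteDimensional_highestWeightSpace_orbitCoordRep_holds, m ≠ 0). ~120 lines. [difficulty:
provable-now] [BlaeserIkenmeyer2025, arXiv:0907.2850, DerksenMakam2020]
#9 GenInheritance (support) — inheritance for generator types (card P1c): for 1 ≤ m and every e,
every generator type χ of A(closure GL_(m²) per_m) (per_m in its own m² variables, `rename toLex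
(perPoly (Fin m) ℂ)`) yields a generator type χ' of the same size (= same degree) of A(closure
GL_((m+e)²) per_m) (per_m on the top-left block, `Fin.castAdd e` placement). Proof plan: place the
block as a FINAL segment of the lex order (placement changes orbitCoordRep only by an inner
automorphism, an isomorphic GL-algebra); pull back functions along the projection killing the extra
variables: an injective GL_(m²)-equivariant algebra map ℂ[Δ per_m^(m)] → ℂ[Δ per_m^(n)] sending
HWV_χ into HWV_(0,χ) (upper-triangular b restricts to its final block) and bijectively so by
inheritance of multiplicities (Landsberg2017 §8.4.1 / BLMW2011 §5.4; occurring weights have ≤ m²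
parts); decomposability then pulls back by injectivity. [difficulty: M] [Landsberg2017,
arXiv:0907.2850, arXiv:1604.06431]
#9 PowTraceMembership (support) — GIP17 Prop. 5 in point form (analogue of MulmuleySohoni2001 Prop
4.4, whose padded version paddedPerPoly_mem_orbitClosure_detPoly_of_hasDetRepr_holds is proved in
tree and is the template): if per_m = tr(A^m) for an n'×n' matrix A of homogeneous linear forms in
the m² variables (the body of `Literature.Barriers.ValiantsHypothesis.HasPowTraceRepr`, spelled out)
and 1 ≤ m, n' ≤ n = m + e, then per_m on the top-left block lies in closure(GL_(n²)·tr X^m): pad A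
by zeros to n×n, substitute x_ab ↦ A_ab(block variables) — a linear ENDOMORPHISM of the variable
space carrying `powFormLex ℂ n m` to the block permanent — and use
endOrbit_subset_orbitClosure_holds plus rename_mem_orbitClosure_rename_iff_holds for the toLex
transport. [difficulty: provable-now] [GesmundoIkenmeyerPanova2017, MulmuleySohoni2001]
#9 PerPowTraceQP (support) — VP ⇒ quasi-polynomial trace-power representations of the permanent
(Nisan homogenisation; "pc and dc are polynomially equivalent", GIP17 §2.2), in window form: if
(per_n) is a VP family then for some c every per_m (m ≥ 1) is tr(A^m) with A an n×n matrix of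
homogeneous linear forms of size exactly n = m + e ≤ 2^((log₂ m + c)^c) (pad a smaller A with zero
rows and columns). Proof plan: isQPBounded_determinantalComplexity_of_isVPFamily_holds (in tree)
gives per_m = det of an affine N×N matrix with N qp(m); det_N has an algebraic branching program of
size poly(N) (MahajanVinay1997 / Berkowitz1984); homogenise to an m-layered ABP with linear-form
edge labels (per_m is homogeneous of degree m), read it as (L₁⋯L_m)_(1,1) and close the layers into
one block-cyclic matrix A of size m·width with tr(A^m) = m·(L₁'L₂⋯L_m)_(11)-type sum, absorbing the
factor 1/m into L₁ (char 0); finally m ≤ 2^((log₂ m + c)^c) for c ≥ 1 lets one pad to size ≥ m.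
[difficulty: M] [Nisan1991, MahajanVinay1997, ValiantSkyumBerkowitzRackoff1983,
GesmundoIkenmeyerPanova2017]
#9 CruxesToThesis (support) — pure logic, PROVED sorry-free in the planner's Sketch.lean (theorem
cruxesToThesis_holds, 15 lines): K1 → K2 → GenInheritance → GenFlipThesis. Given c, take c₀ from K2,
then (m, χ) from K1 at constant c₀ beyond max(m₀,1); for n = m + e in the window inherit χ to χ' of
the same size with γ_χ'(per) ≠ 0; K2 forces γ_χ'(tr X^m) = 0 (else its degree bound contradicts
K1's), so 0 = γ_χ'(tr X^m) < γ_χ'(per_m). [difficulty: provable-now] [DerksenMakam2020]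
#9 NoGenFlipBeyondPoly (support) — NEGATIVE SIDE / kill criterion (γ-analogue of GIP17 Thm 10 lifted
to orbit CLOSURES and of GCTMult.GctNoMultBarrier): from some polynomial matrix size n = m + e ≥
m^c₀ on, γ_χ(per_m) ≤ γ_χ(tr X^m) for every weight χ — no generator obstruction at all. A proof
refutes GenFlipThesis (the window [m, 2^((log₂ m + c)^c)] contains n = m^c₀ once c > c₀) and closes
the route. Not known even for occurrence in the closure setting (GIP17 remark after Thm 10;
Burgisser2024Completeness §7.5). Filed unranked for refuters. [difficulty: open-problem]
[GesmundoIkenmeyerPanova2017, Burgisser2024Completeness, arXiv:1604.06431]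

TWO-LAYER PLAN. Foreseen glued splits (none filed now; k ≤ 3, depth 1): PerGenDegreeSuperQP ⇐
PerClosedOrbitSurjection (B_m ↠ (⊕_λ V_λ*)^(H_per) degree-non-increasing,
DerksenMakam2020 Thm 1.5 for the U-invariant algebra) → FlagInvariantsLateGenerators (indecomposable
H_per-invariants of level > qp(m)) → PerGenDegreeSuperQP;
PowGenDegreeQP ⇐ TraceOrbitCovariants (A of the ORBIT GL·tr X^m = (flag algebra)^(Stab tr X^m),
GIP17 Thm 7–8, generated in qp degree: Razmyslov–Procesi-type
trace identities) → ClosureBoundaryControl (boundary components add no late generators inside the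
window) → PowGenDegreeQP; GenBeatsMult ⇐ certified hwv tables
at (3,3), degrees 4–6 (kit job + Lean certificate) → GenBeatsMult.

KILL CRITERIA. NoGenFlipBeyondPoly proved (or any theorem "no generator obstruction for n ≥
poly(m)") ⇒ close refuted:GenFlipThesis. ¬PerGenDegreeSuperQP in the strong
form "A(closure GL_(m²) per_m) is generated in degree qp(m)" ⇒ the overflow engine is dead: pivot to
GenBeatsMult/PolyWindowFlip-type located flips (the
absorbed second-order-multiplicities index N^ν rides along as the alternative flip type) or retire.
¬PowGenDegreeQP (a subvariety of closure(GL tr X^m)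
inside the window with super-qp generation degree) ⇒ retire the trace-power form; the
padded-determinant variant (B vs A(Δ det_n)) becomes a GCTMult child,
not this route. GenBeatsMult refuted at all computed cells with a structural reason (γ determined by
multiplicities in this family) ⇒ merge into GCTMult.
GctThesis/DetQP proved elsewhere moots the route.

NOT DECOMPOSED YET. Which weight χ carries the first flip; the H_per-invariant theory of the flag
algebra (level structure, Birkhoff obstruction) under K1; the description of
A(GL·tr X^m) via the stabiliser (GIP17 Thm 7) and Razmyslov–Procesi degree bounds under K2; boundary
components of closure(GL tr X^m); certified hwv
computations at (3,3) — all layer-2 children or `--supports` lemmas of provers. A Literature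
definition `covariantGeneratorRank f m χ` (the inlined γ) would
shorten every statement; not requested as a blocking definition because all items elaborate as
filed. VOCABULARY NOTE: the barrier catalogue's
`Literature.Barriers.PneNP.blockPerFormLex/powTraceFormLex` and
`Literature.Barriers.ValiantsHypothesis.HasPowTraceRepr` are NOT referenced because that
module does not build on the hub at filing time (syntax error after the 2026-08-15 attribute pass;
farm answers incoherent); the statements use the
tree's characteristic-free `powFormLex` (equal, `powTraceFormLex_eq_powFormLex`), the literal
permanent placed by `Fin.castAdd`, and the spelled-out body of
HasPowTraceRepr, so PowOccurrenceObstructionConjecture-type facts transfer by unfolding. The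
padded-determinant version of the mechanism is
deliberately NOT filed here (Kadish–Landsberg constraints, no exact inheritance): it belongs to
GCTMult's tenure if wanted.

CHEAPEST FALSIFIER. The card's m = 3 profile, now typed as the first cell of GenBeatsMult: kit
computation of hwv bases of Sym^d(Sym³ℂ⁹) weight spaces for d = 4,5,6 (common
kernel of the 8 raising operators; orbit sampling mod two primes as in the card's covgen runs
j000209/j000233/j000234, which validated the method on binary
forms) for closure(GL₉·per₃) and closure(GL₉·tr X³), X 3×3, then γ = rank modulo products of
lower-degree hwv's. If per₃'s generator types through degree 6
are contained in tr X³'s, the axis is invisible at the only fully computable size (discouraging, not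
fatal); if a flip appears with mult(per) ≤ mult(tr),
GenBeatsMult closes positively. Not run here (needs the 9-variable generalisation of the card's
covgen.py, ≈ 1 CPU-day); a refuter should run it first.
Second cheapest: a literature/Macaulay2 check whether the invariant ring of the H_per-action on
low-level flag modules of SL₉ is generated in level ≤ 3.

NUMBERS. Reach lemma (card, from Landsberg2017 Prop 8.3.4.2/Cor 8.3.4.3): closure(GL_(n²) tr X^m) ⊇
σ_n(v_m) has no equations in degree ≤ n, so no
quotient-monotone obstruction of any kind exists below degree n+1; a generator obstruction at size n
needs μ(per_m) > n. Known generation data (card's kit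
runs, binary forms GL₂): μ(σ₂(v_m)) = 3,4,3,4 (m = 6..9); μ(closure x^(m−2)y²) = 4; μ(S⁶ℂ²) = 15,
μ(S⁷ℂ²) = 30; toy generator flip at type (3, 3m−12) for
m = 6..9 with multiplicities 1 = 1. General upper bound (Derksen2015-type: β ≤ (3/8)·dim·σ², σ ≤
m·r^(r²) for SL_r on S^m ℂ^r): generation degree of the
full covariant algebra of m-ics in m² variables ≤ 2^(O(m⁴ log m)) — so K1 asks for growth between
2^((log m)^ω(1)) and 2^(poly(m)). Lower bounds in print:
β ≥ (2/3)(4^n − 1) for SL_(3n) on 4-tuples of cubic forms and 4^n − 1 for 9-tuples of 3-tensors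
(DerksenMakam2020 Thm 1.6, 1.7). pc(per_m) ≤ 2^m − 1
(Grenet; GIP17 §2.2); GIP17 Thm 10: no ORBIT occurrence obstruction for m ≥ 10, n ≥ m + 2. Items at
open: 12 (1 target, 4 cruxes, 6 support, 1 assembly). 2026-08-28 (director-valiant g11 R120/R121
(d), record only — no item moves): gct ENGINE-2 packet W1
(run/shared/lean/pub/pub-gct-max/pub-gct-max-engine-2/W1/README.md §0 + W1-TABLE.tsv sha16
86351471584da28f) = SUPPORT DATA for the width line's c ≤ 1 statements around K1
(PerGenDegreeSuperQP, stmt-11654): e_inv(per₃) = 18 OCCURS-CERT (the degree-18 SL₉-invariant is the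
first one and F_T(per₃) = −50 536 120 320 ≠ 0, two engines, 4/4 pencil coefficients on V₆),
first-occurrence degrees on the rectangular rays (f₁,…,f₉) = (1, 4, 4, 8, 10, 10, 14, 16, 18) at k =
(3, 6, 4, 6, 6, 5, 6, 6, 6), controls e(per₂) = 4 and e_inv(det₃) = 18 reproduced; m = 3 calibration
of e(per_m) (stub_atomLate's input at m = 3), NOT the open c ≥ 2 content — K1 stays OPEN whatever
the table says.

DEFINITION REQUESTS. None blocking: Weight, MatIdx, highestWeightSpace, orbitCoordRep,
orbitMultiplicity, powFormLex, perPoly, IsVPFamily all exist; γ and the trace-power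
representation predicate are inlined (finrank of a submodule quotient; an ∃-matrix clause). Optional
later: `Literature/Computability/AlgebraicComplexity` def `covariantGeneratorRank`
(= the inlined γ) and `covariantGenerationDegree` (μ), to be requested by the tenure planner if
children multiply. MODULE-CONE NOTE (route-repair g2/g3, 2026-08-15): the gate's decl cone is clean
(0/69 unproved constants; `closes` native-OK, staffable YES); the prover guardrail's single unproved
MODULE-cone fact is `Literature.Computability.AlgebraicComplexity.IsVNPFamily.of_isPProjection`
(ValiantClasses.lean; Burgisser2000 §2.1: VNP is closed under p-projections among p-families), which
enters through the operator-only Statement.lean import `…AlgebraicComplexity.ValiantClasses` shared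
by every route of this summit, is used by no item and not by `closes`, cannot be re-routed around by
any route edit, and is routine to discharge (project the VP witness: G' n = aeval (Sum.elim (rename
Sum.inl ∘ a) (X ∘ Sum.inr)) (G (t n)), u' = u ∘ t, then IsVPFamily.of_isPProjection_holds + one
boolSum/aeval commutation lemma) — flagged `needs-fact` in the rev-2 note for the T0 lane. The three
route imports are all load-bearing (powFormLex ∈ PowerTraceStabilizer; MatIdx, orbitMultiplicity ∈
SchurWeylPlethysm; perFamily_mem_VNP_holds ∈ ValiantConjectureProofs, used by `closes`) and every
closed cited Prop def in the 40 Literature modules they add to the Statement's 6-module cone is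
discharged (planner hand audit of import headers, 46 modules, 120 closed Prop defs), so Theorems
files may import that chain freely.

Novelty: Searches (2026-08-15): `lit search --hybrid "generators of the algebra of covariants highest weight
vectors orbit closure obstruction geometric complexity theory"` (15 rows: Landsberg2017 pp.64/312,
Grosshans1997 pp.50/148; rest noise); `lit search --source all "degree bounds generators highest
weight vectors U-invariants orbit closure permanent obstruction"` (rc 75, searchd outage); `lit
galaxy search "generators of the algebra of covariants" --star all` (0 rows); `lit galaxy search
"highest weight vector obstructions" --star all` (0 rows); `lit galaxy search --star pdf --mode bm25
"lower bounds on degrees of generators of the ring of U-invariants … obstruction to orbit closure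
containment permanent determinant"` (12 rows: Grochow–Mulmuley–Qiao ICALP16, EGOW17 rank barrier;
rest noise); `lit frontier ValiantsHypothesis --since 2022` (30 rows; arXiv:2606.08363 read §8:
IMM/hypercomputant stabiliser properties, no generation-degree content); `lit read arXiv:1902.10773`
pp.3–4 (Lemma 1.3, Thm 1.4–1.7 verified); plus the card's searches (galaxy intelligent ×2, hybrid,
greps of BLMW p.18–19, arXiv:0709.0746, BI17, DIP19, Landsberg2017 index) and the triage refuter's
provisional audit.
Nearest prior art found: DerksenMakam2020 = arXiv:1902.10773 (Lemma 1.3 surjections preserve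
generating sets, Thm 1.5 Grosshans lifting, Thm 1.6/1.7 exponential β — for invariant rings of
REPRESENTATIONS, aimed at algorithmic hardness, no containment); arXiv:1901.04576
(DorflerIkenmeyerPanova2020: m  [refs: 2606.08363, 1902.10773, 0709.0746, 1901.04576, 0907.2850, Landsberg2017, Grosshans1997, DerksenMakam2020, DorflerIkenmeyerPanova2020, IkenmeyerKandasamy2019, GesmundoIkenmeyerPanova2017]

Barriers (technique_class: gct, covariant-algebra-structure, generation-degree): - technique_class: gct, covariant-algebra-structure, generation-degree
- Literature.Barriers.ValiantsHypothesis.GCTMatrixPowering: evaded — GIP17 Thm 10 kills ORBIT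
OCCURRENCE obstructions (sm(λ,n) = 0 < q_λ) in exactly this homogeneous setting; a generator flip
may sit at a weight occurring on both sides with equal multiplicities (γ quotients out the products
by which occurring weights are manufactured), and the finitely supported γ^(1) admits no "everything
eventually occurs" analogue; conceded: nothing below degree n+1 (reach lemma), and no flip is known
at any n ≥ m.
- Literature.Barriers.ValiantsHypothesis.GCTOccurrenceObstructions: evaded formally — no occurrence
statement, no padding (BIP19 Thm 1.4 and Kadish–Landsberg shapes concern X^(n−m)per_m vs det_n); the
refuted OccurrenceObstructionConjecture / RouteQP shapes are not restated.
- Literature.Barriers.ValiantsHypothesis.UnpaddedShiftedPartials: evaded — γ and μ are not Hilbert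
functions of derivative spaces nor ranks of linear images of the form; GesmundoLandsberg2017 Thm 2
speaks to shifted partials only; conceded: its degeneration tr X^m ⇝ q^(m/2) shows closure(GL tr
X^m) contains large classical varieties, which is precisely PowGenDegreeQP's risk.
- Literature.Barriers.ValiantsHypothesis.NotViaSaturations: not engaged — no saturation, moment
polytope or stretching; γ^(1) is non-asymptotic and dies under stretching by design (indecomposables
of a submonoid need not be indecomposable upstairs, so only the ALGEBRA

Novelty grade: new-combination —  (refuter refuter-refute-pool-g44-38, 2026-08-15T18:49:41Z; prior: DerksenMakam2020 (arXiv:1902.10773), BurgisserIkenmeyer2017 (arXiv:1511.02927), BLMW2011, Landsberg2017, GesmundoIkenmeyerPanova2017, DorflerIkenmeyerPanova2020, IkenmeyerKandasamy2019)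

History (route lifecycle, newest last):
- 2026-08-16T04:20:49Z · AUTO-CRUX (backfill): GenFlipThesis — hypotheses of the deciding theorem that nothing in the route derives are cruxes (operator:999:1085951)
- 2026-08-23T03:06:07Z · DORMANT — reconciler: no traction for 5.9 d (last activity item-evidence-added at 2026-08-17T05:42:09Z); parked, not closed — `ledger route dormant route-ValiantsHypothes (operator:999:1469656)
- 2026-08-26T04:26:24Z · REACTIVATED — reconciler: reactivated — activity item-proof-filed at 2026-08-26T02:29:42Z after parking at 2026-08-23T03:06:07Z (operator:999:2744390)
- 2026-08-31T21:56:14Z · BROKEN — PowGenDegreeQP (stmt-ValiantsHypothesis-11655, crux) refuted by Summit.ValiantsHypothesis.ValiantsHypothesis.Theorems.GeneratorObstructions.PowGenDegreeQP.not_PowGenDegreeQP (prover-leafhand-val-generatorobstructi-3-g6-0)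
- 2026-09-03T21:57:38Z · CLOSED refuted — refuted:stmt-ValiantsHypothesis-11655 (PowGenDegreeQP) by Summit.ValiantsHypothesis.ValiantsHypothesis.Theorems.GeneratorObstructions.PowGenDegreeQP.not_PowGenDegreeQP (grace expired, auto-close) (gate)

sub-problem: ValiantsHypothesis · status: closed(refuted) · opened planner-plancard-ValiantsHypothesis-ValiantsH-48b6f24e-0 2026-08-15T18:34:30Z · rev 6 · ledger route-ValiantsHypothesis-GeneratorObstructions
GENERATED by the gate from the ledger (D-0016/17). Provers cite these decls: `theorem foo : Summit.ValiantsHypothesis.ValiantsHypothesis.Theses.GeneratorObstructions.<Decl> := …` in Summits/ValiantsHypothesis/ValiantsHypothesis/Theorems/<Name>.lean.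
-/

namespace Summit.ValiantsHypothesis.ValiantsHypothesis.Theses.GeneratorObstructions

open scoped BigOperators Topology Manifold Classical MeasureTheory ProbabilityTheory Matrix InnerProductSpace ComplexConjugate ContinuousMap
open Filter Set Function TopologicalSpace MeasureTheory

attribute [summit_statement] _root_.ValiantsHypothesis

open Literature.PNP

/-- item stmt-ValiantsHypothesis-11653 · crux (kind.auto-crux: conjecture-grade) · rank 0 · closed · moot by None · by planner
why it might fail: no generator (or multiplicity) flip is known at any (m,n) with n ≥ m in the per/trace family; a homogeneous no-go past n ≥ m^c₀ (NoGenFlipBeyondPoly, the γ-analogue of GIP17 Thm 10 lifted to closures) kills it; the reach lemma forbids flips below degree n+1.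
sources: GesmundoIkenmeyerPanova2017, DerksenMakam2020, DorflerIkenmeyerPanova2020, arXiv:0907.2850
[target] for every c and every m₀ there is m ≥ max(m₀,1) such that for all n = m + e ≤ 2^((log₂ m +
c)^c) some weight χ of GL_(n²) (lex Borel on MatIdx n) has γ_χ(tr X^m) < γ_χ(per_m), γ_χ(f) =
finrank of HWV_χ(ℂ[Δ_m f]) modulo the span of products of highest-weight vectors of complementary
nonzero weights (card thesis GenTypeObstructionQP, in "for infinitely many m" form). -/
@[route_item "route-ValiantsHypothesis-GeneratorObstructions"]
def GenFlipThesis : Prop :=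
  ∀ c m₀ : ℕ, ∃ m : ℕ, m₀ ≤ m ∧ 1 ≤ m ∧ ∀ e : ℕ, m + e ≤ 2 ^ ((Nat.log 2 m + c) ^ c) → ∃ χ : Literature.NumberTheory.DiophantineGeometry.Weight (Literature.NumberTheory.DiophantineGeometry.MatIdx (m + e)), Module.finrank ℂ (↥(Literature.NumberTheory.DiophantineGeometry.highestWeightSpace (Literature.Computability.AlgebraicComplexity.orbitCoordRep (Literature.NumberTheory.DiophantineGeometry.powFormLex ℂ (m + e) m) m) χ) ⧸ Submodule.comap (Literature.NumberTheory.DiophantineGeometry.highestWeightSpace (Literature.Computability.AlgebraicComplexity.orbitCoordRep (Literature.NumberTheory.DiophantineGeometry.powFormLex ℂ (m + e) m) m) χ).subtype (⨆ p : Literature.NumberTheory.DiophantineGeometry.Weight (Literature.NumberTheory.DiophantineGeometry.MatIdx (m + e)) × Literature.NumberTheory.DiophantineGeometry.Weight (Literature.NumberTheory.DiophantineGeometry.MatIdx (m + e)), ⨆ (_ : p.1 + p.2 = χ ∧ p.1 ≠ 0 ∧ p.2 ≠ 0), Literature.NumberTheory.DiophantineGeometry.highestWeightSpace (Literature.Computability.AlgebraicComplexity.orbitCoordRep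 (Literature.NumberTheory.DiophantineGeometry.powFormLex ℂ (m + e) m) m) p.1 * Literature.NumberTheory.DiophantineGeometry.highestWeightSpace (Literature.Computability.AlgebraicComplexity.orbitCoordRep (Literature.NumberTheory.DiophantineGeometry.powFormLex ℂ (m + e) m) m) p.2)) < Module.finrank ℂ (↥(Literature.NumberTheory.DiophantineGeometry.highestWeightSpace (Literature.Computability.AlgebraicComplexity.orbitCoordRep (MvPolynomial.rename (fun ij : Fin m × Fin m => toLex (Fin.castAdd e ij.1, Fin.castAdd e ij.2)) (Literature.Computability.AlgebraicComplexity.perPoly (Fin m) ℂ)) m) χ) ⧸ Submodule.comap (Literature.NumberTheory.DiophantineGeometry.highestWeightSpace (Literature.Computability.AlgebraicComplexity.orbitCoordRep (MvPolynomial.rename (fun ij : Fin m × Fin m => toLex (Fin.castAdd e ij.1, Fin.castAdd e ij.2)) (Literature.Computability.AlgebraicComplexity.perPoly (Fin m) ℂ)) m) χ).subtype (⨆ p : Literature.NumberTheory.DiophantineGeometry.Weight (Literature.NumberTheory.DiophantineGeometry.MatIdx (m + e)) × Literature.NumberTheory.DiophantineGeometry.Weight (Literature.NumberTheory.DiophantineGeometry.MatIdx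 (m + e)), ⨆ (_ : p.1 + p.2 = χ ∧ p.1 ≠ 0 ∧ p.2 ≠ 0), Literature.NumberTheory.DiophantineGeometry.highestWeightSpace (Literature.Computability.AlgebraicComplexity.orbitCoordRep (MvPolynomial.rename (fun ij : Fin m × Fin m => toLex (Fin.castAdd e ij.1, Fin.castAdd e ij.2)) (Literature.Computability.AlgebraicComplexity.perPoly (Fin m) ℂ)) m) p.1 * Literature.NumberTheory.DiophantineGeometry.highestWeightSpace (Literature.Computability.AlgebraicComplexity.orbitCoordRep (MvPolynomial.rename (fun ij : Fin m × Fin m => toLex (Fin.castAdd e ij.1, Fin.castAdd e ij.2)) (Literature.Computability.AlgebraicComplexity.perPoly (Fin m) ℂ)) m) p.2))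

/-- item stmt-ValiantsHypothesis-11654 · crux · rank 2 · closed · moot by None · by planner
why it might fail: per's row/column torus has bipartite unimodular weights (Birkhoff: magic squares generated in degree m), so the flag-algebra H_per-invariants may be generated in poly(m) level and B_m in qp(m) degree — the card's own fastest refutation; no super-polynomial μ is known for any explicit orbit closure.
sources: DerksenMakam2020, BurgisserIkenmeyer2017, Grosshans1997, arXiv:0907.2850
[crux] K1 (card K1): the generation degree μ(per_m) of B_m = A(closure GL_(m²)·per_m) (per_m in its
own m² variables, `rename toLex (perPoly (Fin m) ℂ)`) is not quasi-polynomially bounded: for every c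
and m₀ there are m ≥ m₀ and a weight χ of GL_(m²) with γ_χ(per_m) ≠ 0 and degree −|χ|/m > 2^((log₂ m
+ c)^c). Proposed engine: B_m ↠ (⊕_λ V_λ*)^(H_per) along per's closed SL-orbit
(Grosshans/Derksen–Makam lifting; H_per = T^(2m−2)⋊(S_m×S_m⋊2) is torus-by-finite) and
indecomposable H_per-invariants of super-quasi-polynomial level. [difficulty: open-problem] -/
@[route_item "route-ValiantsHypothesis-GeneratorObstructions"]
def PerGenDegreeSuperQP : Prop :=
  ∀ c m₀ : ℕ, ∃ m : ℕ, m₀ ≤ m ∧ ∃ χ : Literature.NumberTheory.DiophantineGeometry.Weight (Literature.NumberTheory.DiophantineGeometry.MatIdx m), Module.finrank ℂ (↥(Literature.NumberTheory.DiophantineGeometry.highestWeightSpace (Literature.Computability.AlgebraicComplexity.orbitCoordRep (MvPolynomial.rename toLex (Literature.Computability.AlgebraicComplexity.perPoly (Fin m) ℂ)) m) χ) ⧸ Submodule.comap (Literature.NumberTheory.DiophantineGeometry.highestWeightSpace (Literature.Computability.AlgebraicComplexity.orbitCoordRep (MvPolynomial.rename toLex (Literature.Computability.AlgebraicComplexity.perPoly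 (Fin m) ℂ)) m) χ).subtype (⨆ p : Literature.NumberTheory.DiophantineGeometry.Weight (Literature.NumberTheory.DiophantineGeometry.MatIdx m) × Literature.NumberTheory.DiophantineGeometry.Weight (Literature.NumberTheory.DiophantineGeometry.MatIdx m), ⨆ (_ : p.1 + p.2 = χ ∧ p.1 ≠ 0 ∧ p.2 ≠ 0), Literature.NumberTheory.DiophantineGeometry.highestWeightSpace (Literature.Computability.AlgebraicComplexity.orbitCoordRep (MvPolynomial.rename toLex (Literature.Computability.AlgebraicComplexity.perPoly (Fin m) ℂ)) m) p.1 * Literature.NumberTheory.DiophantineGeometry.highestWeightSpace (Literature.Computability.AlgebraicComplexity.orbitCoordRep (MvPolynomial.rename toLex (Literature.Computability.AlgebraicComplexity.perPoly (Fin m) ℂ)) m) p.2)) ≠ 0 ∧ (m : ℤ) * 2 ^ ((Nat.log 2 m + c) ^ c) < -(Literature.NumberTheory.DiophantineGeometry.Weight.size χ)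

/-- item stmt-ValiantsHypothesis-11655 · crux · rank 3 · closed · refuted by Summit.ValiantsHypothesis.ValiantsHypothesis.Theorems.GeneratorObstructions.PowGenDegreeQP.not_PowGenDegreeQP (prover) · by planner
why it might fail: A(Z_(n,m)) surjects onto A(Y) for every GL-stable closed Y ⊆ Z (Chow variety, closures of GL·(per_k·monomial) with k ≈ log n, subspace varieties): if any Y is generated only beyond degree qp(m) — a U-invariant DerksenMakam2020 Thm 1.6 inside the window — K2 fails trivially.
sources: DerksenMakam2020, GesmundoIkenmeyerPanova2017, Derksen2015, arXiv:1611.00827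
[crux] K2 in WINDOW form: for every c there is c₀ such that for all 1 ≤ m ≤ n = m + e ≤ 2^((log₂ m +
c)^c) every generator type χ of A(closure GL_(n²)·tr X^m) has degree −|χ|/m ≤ 2^((log₂ m + c₀)^c₀)
(the trace-power side is generated in quasi-polynomial degree throughout the qp window). Restricted
from the card's uniform K2 (all m ≤ n), which is exposed to exponential generation-degree lower
bounds of subspace varieties of low-degree forms. [difficulty: open-problem] -/
@[route_item "route-ValiantsHypothesis-GeneratorObstructions"]
def PowGenDegreeQP : Prop :=
  ∀ c : ℕ, ∃ c₀ : ℕ, ∀ m e : ℕ, 1 ≤ m → m + e ≤ 2 ^ ((Nat.log 2 m + c) ^ c) → ∀ χ : Literature.NumberTheory.DiophantineGeometry.Weight (Literature.NumberTheory.DiophantineGeometry.MatIdx (m + e)), Module.finrank ℂ (↥(Literature.NumberTheory.DiophantineGeometry.highestWeightSpace (Literature.Computability.AlgebraicComplexity.orbitCoordRep (Literature.NumberTheory.DiophantineGeometry.powFormLex ℂ (m + e) m) m) χ) ⧸ Submodule.comap (Literature.NumberTheory.DiophantineGeometry.highestWeightSpace (Literature.Computability.AlgebraicComplexity.orbitCoordRep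 (Literature.NumberTheory.DiophantineGeometry.powFormLex ℂ (m + e) m) m) χ).subtype (⨆ p : Literature.NumberTheory.DiophantineGeometry.Weight (Literature.NumberTheory.DiophantineGeometry.MatIdx (m + e)) × Literature.NumberTheory.DiophantineGeometry.Weight (Literature.NumberTheory.DiophantineGeometry.MatIdx (m + e)), ⨆ (_ : p.1 + p.2 = χ ∧ p.1 ≠ 0 ∧ p.2 ≠ 0), Literature.NumberTheory.DiophantineGeometry.highestWeightSpace (Literature.Computability.AlgebraicComplexity.orbitCoordRep (Literature.NumberTheory.DiophantineGeometry.powFormLex ℂ (m + e) m) m) p.1 * Literature.NumberTheory.DiophantineGeometry.highestWeightSpace (Literature.Computability.AlgebraicComplexity.orbitCoordRep (Literature.NumberTheory.DiophantineGeometry.powFormLex ℂ (m + e) m) m) p.2)) ≠ 0 → -(Literature.NumberTheory.DiophantineGeometry.Weight.size χ) ≤ (m : ℤ) * 2 ^ ((Nat.log 2 m + c₀) ^ c₀)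

/-- item stmt-ValiantsHypothesis-11656 · aside · rank 4 · closed · moot by None · by planner
why it might fail: per_3 ∉ closure(GL_9 tr X³) need not be certified by ANY dimension datum of A (the card's honesty rider: x³y³ ∉ σ₃(v₆(P¹)) is invisible to γ through degree 12); at (3,3) hwv spaces of Sym^d(Sym³ℂ⁹), d ≥ 4, must be computed modulo products.
sources: DorflerIkenmeyerPanova2020, IkenmeyerKandasamy2019, arXiv:1901.04576, GesmundoIkenmeyerPanova2017
[crux] the new axis is genuinely finer SOMEWHERE in the per/trace-power family: there are 3 ≤ m ≤ n
= m + e and a weight χ of GL_(n²) with a generator flip γ_χ(tr X^m) < γ_χ(per_m) although the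
multiplicity of χ in ℂ[Δ(per_m)] is at most that in ℂ[Δ(tr X^m)] (no multiplicity obstruction at χ).
Decisive existence question; first cells (m,n) = (3,3), (3,4), (4,4), degrees n+1 … 2n by the reach
lemma; the binary-form toy of the card (γ flip at (3, 3m−12) with equal multiplicities) is the
model. [difficulty: L] -/
@[route_item "route-ValiantsHypothesis-GeneratorObstructions"]
def GenBeatsMult : Prop :=
  ∃ m e : ℕ, 3 ≤ m ∧ ∃ χ : Literature.NumberTheory.DiophantineGeometry.Weight (Literature.NumberTheory.DiophantineGeometry.MatIdx (m + e)), Module.finrank ℂ (↥(Literature.NumberTheory.DiophantineGeometry.highestWeightSpace (Literature.Computability.AlgebraicComplexity.orbitCoordRep (Literature.NumberTheory.DiophantineGeometry.powFormLex ℂ (m + e) m) m) χ) ⧸ Submodule.comap (Literature.NumberTheory.DiophantineGeometry.highestWeightSpace (Literature.Computability.AlgebraicComplexity.orbitCoordRep (Literature.NumberTheory.DiophantineGeometry.powFormLex ℂ (m + e) m) m) χ).subtype (⨆ p : Literature.NumberTheory.DiophantineGeometry.Weight (Literature.NumberTheory.DiophantineGeometry.MatIdx (m + e)) × Literature.NumberTheory.DiophantineGeometry.Weight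 (Literature.NumberTheory.DiophantineGeometry.MatIdx (m + e)), ⨆ (_ : p.1 + p.2 = χ ∧ p.1 ≠ 0 ∧ p.2 ≠ 0), Literature.NumberTheory.DiophantineGeometry.highestWeightSpace (Literature.Computability.AlgebraicComplexity.orbitCoordRep (Literature.NumberTheory.DiophantineGeometry.powFormLex ℂ (m + e) m) m) p.1 * Literature.NumberTheory.DiophantineGeometry.highestWeightSpace (Literature.Computability.AlgebraicComplexity.orbitCoordRep (Literature.NumberTheory.DiophantineGeometry.powFormLex ℂ (m + e) m) m) p.2)) < Module.finrank ℂ (↥(Literature.NumberTheory.DiophantineGeometry.highestWeightSpace (Literature.Computability.AlgebraicComplexity.orbitCoordRep (MvPolynomial.rename (fun ij : Fin m × Fin m => toLex (Fin.castAdd e ij.1, Fin.castAdd e ij.2)) (Literature.Computability.AlgebraicComplexity.perPoly (Fin m) ℂ)) m) χ) ⧸ Submodule.comap (Literature.NumberTheory.DiophantineGeometry.highestWeightSpace (Literature.Computability.AlgebraicComplexity.orbitCoordRep (MvPolynomial.rename (fun ij : Fin m × Fin m => toLex (Fin.castAdd e ij.1, Fin.castAdd e ij.2)) (Literature.Computability.AlgebraicComplexity.perPoly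 (Fin m) ℂ)) m) χ).subtype (⨆ p : Literature.NumberTheory.DiophantineGeometry.Weight (Literature.NumberTheory.DiophantineGeometry.MatIdx (m + e)) × Literature.NumberTheory.DiophantineGeometry.Weight (Literature.NumberTheory.DiophantineGeometry.MatIdx (m + e)), ⨆ (_ : p.1 + p.2 = χ ∧ p.1 ≠ 0 ∧ p.2 ≠ 0), Literature.NumberTheory.DiophantineGeometry.highestWeightSpace (Literature.Computability.AlgebraicComplexity.orbitCoordRep (MvPolynomial.rename (fun ij : Fin m × Fin m => toLex (Fin.castAdd e ij.1, Fin.castAdd e ij.2)) (Literature.Computability.AlgebraicComplexity.perPoly (Fin m) ℂ)) m) p.1 * Literature.NumberTheory.DiophantineGeometry.highestWeightSpace (Literature.Computability.AlgebraicComplexity.orbitCoordRep (MvPolynomial.rename (fun ij : Fin m × Fin m => toLex (Fin.castAdd e ij.1, Fin.castAdd e ij.2)) (Literature.Computability.AlgebraicComplexity.perPoly (Fin m) ℂ)) m) p.2)) ∧ Literature.NumberTheory.DiophantineGeometry.orbitMultiplicity ℂ (MvPolynomial.rename (fun ij : Fin m × Fin m => toLex (Fin.castAdd e ij.1, Fin.castAdd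 e ij.2)) (Literature.Computability.AlgebraicComplexity.perPoly (Fin m) ℂ)) m χ ≤ Literature.NumberTheory.DiophantineGeometry.orbitMultiplicity ℂ (Literature.NumberTheory.DiophantineGeometry.powFormLex ℂ (m + e) m) m χ

/-- item stmt-ValiantsHypothesis-11657 · aside · rank 5 · closed · moot by None · by planner
why it might fail: needs highest-weight-vector spaces of closure(GL_(n²) tr X^m) modulo products in degrees > n (reach lemma), beyond computation even for m = 3; and flips may exist only in the overflow regime of K1 ∧ K2, not at polynomial n.
sources: GesmundoIkenmeyerPanova2017, arXiv:1611.00827, BlaeserIkenmeyer2025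
[crux] unconditional polynomial window (card K3): for infinitely many m, at every n = m + e ≤ m³
there is a generator flip γ_χ(tr X^m) < γ_χ(per_m); with GenPrinciple and PowTraceMembership this
proves pc(per_m) > m³ infinitely often — the first superlinear lower bound in the homogeneous GCT
setting (GIP17 Thm 10 excludes orbit occurrence obstructions already for n ≥ m+2). [deps:
GenBeatsMult] [difficulty: open-problem] -/
@[route_item "route-ValiantsHypothesis-GeneratorObstructions"]
def PolyWindowFlip : Prop :=
  ∀ m₀ : ℕ, ∃ m : ℕ, m₀ ≤ m ∧ ∀ e : ℕ, m + e ≤ m ^ 3 → ∃ χ : Literature.NumberTheory.DiophantineGeometry.Weight (Literature.NumberTheory.DiophantineGeometry.MatIdx (m + e)), Module.finrank ℂ (↥(Literature.NumberTheory.DiophantineGeometry.highestWeightSpace (Literature.Computability.AlgebraicComplexity.orbitCoordRep (Literature.NumberTheory.DiophantineGeometry.powFormLex ℂ (m + e) m) m) χ) ⧸ Submodule.comap (Literature.NumberTheory.DiophantineGeometry.highestWeightSpace (Literature.Computability.AlgebraicComplexity.orbitCoordRep (Literature.NumberTheory.DiophantineGeometry.powFormLex ℂ (m + e) m) m) χ).subtype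 (⨆ p : Literature.NumberTheory.DiophantineGeometry.Weight (Literature.NumberTheory.DiophantineGeometry.MatIdx (m + e)) × Literature.NumberTheory.DiophantineGeometry.Weight (Literature.NumberTheory.DiophantineGeometry.MatIdx (m + e)), ⨆ (_ : p.1 + p.2 = χ ∧ p.1 ≠ 0 ∧ p.2 ≠ 0), Literature.NumberTheory.DiophantineGeometry.highestWeightSpace (Literature.Computability.AlgebraicComplexity.orbitCoordRep (Literature.NumberTheory.DiophantineGeometry.powFormLex ℂ (m + e) m) m) p.1 * Literature.NumberTheory.DiophantineGeometry.highestWeightSpace (Literature.Computability.AlgebraicComplexity.orbitCoordRep (Literature.NumberTheory.DiophantineGeometry.powFormLex ℂ (m + e) m) m) p.2)) < Module.finrank ℂ (↥(Literature.NumberTheory.DiophantineGeometry.highestWeightSpace (Literature.Computability.AlgebraicComplexity.orbitCoordRep (MvPolynomial.rename (fun ij : Fin m × Fin m => toLex (Fin.castAdd e ij.1, Fin.castAdd e ij.2)) (Literature.Computability.AlgebraicComplexity.perPoly (Fin m) ℂ)) m) χ) ⧸ Submodule.comap (Literature.NumberTheory.DiophantineGeometry.highestWeightSpace (Literature.Computability.AlgebraicComplexity.orbitCoordRep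 (MvPolynomial.rename (fun ij : Fin m × Fin m => toLex (Fin.castAdd e ij.1, Fin.castAdd e ij.2)) (Literature.Computability.AlgebraicComplexity.perPoly (Fin m) ℂ)) m) χ).subtype (⨆ p : Literature.NumberTheory.DiophantineGeometry.Weight (Literature.NumberTheory.DiophantineGeometry.MatIdx (m + e)) × Literature.NumberTheory.DiophantineGeometry.Weight (Literature.NumberTheory.DiophantineGeometry.MatIdx (m + e)), ⨆ (_ : p.1 + p.2 = χ ∧ p.1 ≠ 0 ∧ p.2 ≠ 0), Literature.NumberTheory.DiophantineGeometry.highestWeightSpace (Literature.Computability.AlgebraicComplexity.orbitCoordRep (MvPolynomial.rename (fun ij : Fin m × Fin m => toLex (Fin.castAdd e ij.1, Fin.castAdd e ij.2)) (Literature.Computability.AlgebraicComplexity.perPoly (Fin m) ℂ)) m) p.1 * Literature.NumberTheory.DiophantineGeometry.highestWeightSpace (Literature.Computability.AlgebraicComplexity.orbitCoordRep (MvPolynomial.rename (fun ij : Fin m × Fin m => toLex (Fin.castAdd e ij.1, Fin.castAdd e ij.2)) (Literature.Computability.AlgebraicComplexity.perPoly (Fin m) ℂ)) m) p.2))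

/-- item stmt-ValiantsHypothesis-11658 · support · rank 9 · closed · proved by Summit.ValiantsHypothesis.ValiantsHypothesis.Theorems.GeneratorObstructionsGenPrinciple.genPrinciple_proof @ ef7c55cd1554 (prover) · by planner
sources: BlaeserIkenmeyer2025, arXiv:0907.2850, DerksenMakam2020
[support] generator-obstruction principle (card P1a–b), provable now: over ℂ, for forms in finitely
many linearly ordered variables and m ≠ 0, g ∈ Δ(f) ⇒ γ_χ(g) ≤ γ_χ(f) for every weight χ. Proof:
restriction orbitCoordRestrict : ℂ[Δ_m f] ↠ ℂ[Δ_m g] is a GL-equivariant ALGEBRA surjection; ℂ[Δ_m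
f] is completely reducible (isSemisimpleRepresentation_orbitCoordRep) so highest-weight spaces
surject (map_highestWeightSpace_eq_of_surjective, MultiplicityObstructionsProofs.lean); products of
highest-weight vectors of weights χ₁, χ₂ are highest-weight vectors of weight χ₁+χ₂ (ρ(g) is an
algebra automorphism, weightChar multiplicative), so the decomposable span maps INTO the
decomposable span; quotients then surject and finrank is monotone
(finiteDimensional_highestWeightSpace_orbitCoordRep_holds, m ≠ 0). ~120 lines. [difficulty:
provable-now] -/
@[route_item "route-ValiantsHypothesis-GeneratorObstructions"]
def GenPrinciple : Prop :=
  ∀ {σ : Type} [Fintype σ] [LinearOrder σ] (f g : MvPolynomial σ ℂ) (m : ℕ), m ≠ 0 → g ∈ Literature.Computability.AlgebraicComplexity.orbitClosure f → ∀ χ : Literature.NumberTheory.DiophantineGeometry.Weight σ, Module.finrank ℂ (↥(Literature.NumberTheory.DiophantineGeometry.highestWeightSpace (Literature.Computability.AlgebraicComplexity.orbitCoordRep (g) m) χ) ⧸ Submodule.comap (Literature.NumberTheory.DiophantineGeometry.highestWeightSpace (Literature.Computability.AlgebraicComplexity.orbitCoordRep (g) m) χ).subtype (⨆ p : Literature.NumberTheory.DiophantineGeometry.Weight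 σ × Literature.NumberTheory.DiophantineGeometry.Weight σ, ⨆ (_ : p.1 + p.2 = χ ∧ p.1 ≠ 0 ∧ p.2 ≠ 0), Literature.NumberTheory.DiophantineGeometry.highestWeightSpace (Literature.Computability.AlgebraicComplexity.orbitCoordRep (g) m) p.1 * Literature.NumberTheory.DiophantineGeometry.highestWeightSpace (Literature.Computability.AlgebraicComplexity.orbitCoordRep (g) m) p.2)) ≤ Module.finrank ℂ (↥(Literature.NumberTheory.DiophantineGeometry.highestWeightSpace (Literature.Computability.AlgebraicComplexity.orbitCoordRep (f) m) χ) ⧸ Submodule.comap (Literature.NumberTheory.DiophantineGeometry.highestWeightSpace (Literature.Computability.AlgebraicComplexity.orbitCoordRep (f) m) χ).subtype (⨆ p : Literature.NumberTheory.DiophantineGeometry.Weight σ × Literature.NumberTheory.DiophantineGeometry.Weight σ, ⨆ (_ : p.1 + p.2 = χ ∧ p.1 ≠ 0 ∧ p.2 ≠ 0), Literature.NumberTheory.DiophantineGeometry.highestWeightSpace (Literature.Computability.AlgebraicComplexity.orbitCoordRep (f) m) p.1 * Literature.NumberTheory.DiophantineGeometry.highestWeightSpace (Literature.Computability.AlgebraicComplexity.orbitCoordRep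 (f) m) p.2))

-- `GenPrinciple` holds: proved by `Summit.ValiantsHypothesis.ValiantsHypothesis.Theorems.GeneratorObstructionsGenPrinciple.genPrinciple_proof` @ ef7c55cd1554 (its module imports this route file, so no `_holds` link can be stated here).

/-- item stmt-ValiantsHypothesis-11659 · support · rank 9 · closed · proved by Summit.ValiantsHypothesis.ValiantsHypothesis.Theorems.genInheritance_proof @ 5e2016f67110 (prover) · by planner
sources: Landsberg2017, arXiv:0907.2850, arXiv:1604.06431
[support] inheritance for generator types (card P1c): for 1 ≤ m and every e, every generator type χ
of A(closure GL_(m²) per_m) (per_m in its own m² variables, `rename toLex (perPoly (Fin m) ℂ)`)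
yields a generator type χ' of the same size (= same degree) of A(closure GL_((m+e)²) per_m) (per_m
on the top-left block, `Fin.castAdd e` placement). Proof plan: place the block as a FINAL segment of
the lex order (placement changes orbitCoordRep only by an inner automorphism, an isomorphic
GL-algebra); pull back functions along the projection killing the extra variables: an injective
GL_(m²)-equivariant algebra map ℂ[Δ per_m^(m)] → ℂ[Δ per_m^(n)] sending HWV_χ into HWV_(0,χ)
(upper-triangular b restricts to its final block) and bijectively so by inheritance of
multiplicities (Landsberg2017 §8.4.1 / BLMW2011 §5.4; occurring weights have ≤ m² parts);
decomposability then pulls back by injectivity. [difficulty: M] -/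
@[route_item "route-ValiantsHypothesis-GeneratorObstructions"]
def GenInheritance : Prop :=
  ∀ m e : ℕ, 1 ≤ m → ∀ χ : Literature.NumberTheory.DiophantineGeometry.Weight (Literature.NumberTheory.DiophantineGeometry.MatIdx m), Module.finrank ℂ (↥(Literature.NumberTheory.DiophantineGeometry.highestWeightSpace (Literature.Computability.AlgebraicComplexity.orbitCoordRep (MvPolynomial.rename toLex (Literature.Computability.AlgebraicComplexity.perPoly (Fin m) ℂ)) m) χ) ⧸ Submodule.comap (Literature.NumberTheory.DiophantineGeometry.highestWeightSpace (Literature.Computability.AlgebraicComplexity.orbitCoordRep (MvPolynomial.rename toLex (Literature.Computability.AlgebraicComplexity.perPoly (Fin m) ℂ)) m) χ).subtype (⨆ p : Literature.NumberTheory.DiophantineGeometry.Weight (Literature.NumberTheory.DiophantineGeometry.MatIdx m) × Literature.NumberTheory.DiophantineGeometry.Weight (Literature.NumberTheory.DiophantineGeometry.MatIdx m), ⨆ (_ : p.1 + p.2 = χ ∧ p.1 ≠ 0 ∧ p.2 ≠ 0), Literature.NumberTheory.DiophantineGeometry.highestWeightSpace (Literature.Computability.AlgebraicComplexity.orbitCoordRep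 (MvPolynomial.rename toLex (Literature.Computability.AlgebraicComplexity.perPoly (Fin m) ℂ)) m) p.1 * Literature.NumberTheory.DiophantineGeometry.highestWeightSpace (Literature.Computability.AlgebraicComplexity.orbitCoordRep (MvPolynomial.rename toLex (Literature.Computability.AlgebraicComplexity.perPoly (Fin m) ℂ)) m) p.2)) ≠ 0 → ∃ χ' : Literature.NumberTheory.DiophantineGeometry.Weight (Literature.NumberTheory.DiophantineGeometry.MatIdx (m + e)), Literature.NumberTheory.DiophantineGeometry.Weight.size χ' = Literature.NumberTheory.DiophantineGeometry.Weight.size χ ∧ Module.finrank ℂ (↥(Literature.NumberTheory.DiophantineGeometry.highestWeightSpace (Literature.Computability.AlgebraicComplexity.orbitCoordRep (MvPolynomial.rename (fun ij : Fin m × Fin m => toLex (Fin.castAdd e ij.1, Fin.castAdd e ij.2)) (Literature.Computability.AlgebraicComplexity.perPoly (Fin m) ℂ)) m) χ') ⧸ Submodule.comap (Literature.NumberTheory.DiophantineGeometry.highestWeightSpace (Literature.Computability.AlgebraicComplexity.orbitCoordRep (MvPolynomial.rename (fun ij : Fin m × Fin m => toLex (Fin.castAdd e ij.1, Fin.castAdd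 e ij.2)) (Literature.Computability.AlgebraicComplexity.perPoly (Fin m) ℂ)) m) χ').subtype (⨆ p : Literature.NumberTheory.DiophantineGeometry.Weight (Literature.NumberTheory.DiophantineGeometry.MatIdx (m + e)) × Literature.NumberTheory.DiophantineGeometry.Weight (Literature.NumberTheory.DiophantineGeometry.MatIdx (m + e)), ⨆ (_ : p.1 + p.2 = χ' ∧ p.1 ≠ 0 ∧ p.2 ≠ 0), Literature.NumberTheory.DiophantineGeometry.highestWeightSpace (Literature.Computability.AlgebraicComplexity.orbitCoordRep (MvPolynomial.rename (fun ij : Fin m × Fin m => toLex (Fin.castAdd e ij.1, Fin.castAdd e ij.2)) (Literature.Computability.AlgebraicComplexity.perPoly (Fin m) ℂ)) m) p.1 * Literature.NumberTheory.DiophantineGeometry.highestWeightSpace (Literature.Computability.AlgebraicComplexity.orbitCoordRep (MvPolynomial.rename (fun ij : Fin m × Fin m => toLex (Fin.castAdd e ij.1, Fin.castAdd e ij.2)) (Literature.Computability.AlgebraicComplexity.perPoly (Fin m) ℂ)) m) p.2)) ≠ 0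

-- `GenInheritance` holds: proved by `Summit.ValiantsHypothesis.ValiantsHypothesis.Theorems.genInheritance_proof` @ 5e2016f67110 (its module imports this route file, so no `_holds` link can be stated here).

/-- item stmt-ValiantsHypothesis-11660 · support · rank 9 · closed · proved by Summit.ValiantsHypothesis.ValiantsHypothesis.Theorems.GeneratorObstructions.powTraceMembership_proof (prover) · by planner
sources: GesmundoIkenmeyerPanova2017, MulmuleySohoni2001
[support] GIP17 Prop. 5 in point form (analogue of MulmuleySohoni2001 Prop 4.4, whose padded version
paddedPerPoly_mem_orbitClosure_detPoly_of_hasDetRepr_holds is proved in tree and is the template):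
if per_m = tr(A^m) for an n'×n' matrix A of homogeneous linear forms in the m² variables (the body
of `Literature.Barriers.ValiantsHypothesis.HasPowTraceRepr`, spelled out) and 1 ≤ m, n' ≤ n = m + e,
then per_m on the top-left block lies in closure(GL_(n²)·tr X^m): pad A by zeros to n×n, substitute
x_ab ↦ A_ab(block variables) — a linear ENDOMORPHISM of the variable space carrying `powFormLex ℂ n
m` to the block permanent — and use endOrbit_subset_orbitClosure_holds plus
rename_mem_orbitClosure_rename_iff_holds for the toLex transport. [difficulty: provable-now] -/
@[route_item "route-ValiantsHypothesis-GeneratorObstructions"]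
def PowTraceMembership : Prop :=
  ∀ m e n' : ℕ, 1 ≤ m → n' ≤ m + e → (∃ A : Matrix (Fin (n')) (Fin (n')) (MvPolynomial (Fin m × Fin m) ℂ), (∀ i j, (A i j).IsHomogeneous 1) ∧ (A ^ m).trace = Literature.Computability.AlgebraicComplexity.perPoly (Fin m) ℂ) → MvPolynomial.rename (fun ij : Fin m × Fin m => toLex (Fin.castAdd e ij.1, Fin.castAdd e ij.2)) (Literature.Computability.AlgebraicComplexity.perPoly (Fin m) ℂ) ∈ Literature.Computability.AlgebraicComplexity.orbitClosure (Literature.NumberTheory.DiophantineGeometry.powFormLex ℂ (m + e) m)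

-- `PowTraceMembership` holds: proved by `Summit.ValiantsHypothesis.ValiantsHypothesis.Theorems.GeneratorObstructions.powTraceMembership_proof` (its module imports this route file, so no `_holds` link can be stated here).

/-- item stmt-ValiantsHypothesis-11661 · support · rank 9 · closed · proved by Summit.ValiantsHypothesis.ValiantsHypothesis.Theorems.perPowTraceQP_proof @ 49e7816ebcf6 (prover) · by planner
sources: Nisan1991, MahajanVinay1997, ValiantSkyumBerkowitzRackoff1983, GesmundoIkenmeyerPanova2017
[support] VP ⇒ quasi-polynomial trace-power representations of the permanent (Nisan homogenisation;
"pc and dc are polynomially equivalent", GIP17 §2.2), in window form: if (per_n) is a VP family then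
for some c every per_m (m ≥ 1) is tr(A^m) with A an n×n matrix of homogeneous linear forms of size
exactly n = m + e ≤ 2^((log₂ m + c)^c) (pad a smaller A with zero rows and columns). Proof plan:
isQPBounded_determinantalComplexity_of_isVPFamily_holds (in tree) gives per_m = det of an affine N×N
matrix with N qp(m); det_N has an algebraic branching program of size poly(N) (MahajanVinay1997 /
Berkowitz1984); homogenise to an m-layered ABP with linear-form edge labels (per_m is homogeneous of
degree m), read it as (L₁⋯L_m)_(1,1) and close the layers into one block-cyclic matrix A of size
m·width with tr(A^m) = m·(L₁'L₂⋯L_m)_(11)-type sum, absorbing the factor 1/m into L₁ (char 0);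
finally m ≤ 2^((log₂ m + c)^c) for c ≥ 1 lets one pad to size ≥ m. [difficulty: M] -/
@[route_item "route-ValiantsHypothesis-GeneratorObstructions"]
def PerPowTraceQP : Prop :=
  Literature.Computability.AlgebraicComplexity.IsVPFamily (fun n => Literature.Computability.AlgebraicComplexity.perPoly (Fin n) ℂ) → ∃ c : ℕ, ∀ m : ℕ, 1 ≤ m → ∃ e : ℕ, m + e ≤ 2 ^ ((Nat.log 2 m + c) ^ c) ∧ ∃ A : Matrix (Fin (m + e)) (Fin (m + e)) (MvPolynomial (Fin m × Fin m) ℂ), (∀ i j, (A i j).IsHomogeneous 1) ∧ (A ^ m).trace = Literature.Computability.AlgebraicComplexity.perPoly (Fin m) ℂ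

-- `PerPowTraceQP` holds: proved by `Summit.ValiantsHypothesis.ValiantsHypothesis.Theorems.perPowTraceQP_proof` @ 49e7816ebcf6 (its module imports this route file, so no `_holds` link can be stated here).

/-- item stmt-ValiantsHypothesis-11662 · support · rank 9 · closed · proved by Summit.ValiantsHypothesis.ValiantsHypothesis.Theorems.GeneratorObstructions.cruxesToThesis_proof @ c73224af389e (prover) · by planner
sources: DerksenMakam2020
[support] pure logic, PROVED sorry-free in the planner's Sketch.lean (theorem cruxesToThesis_holds,
15 lines): K1 → K2 → GenInheritance → GenFlipThesis. Given c, take c₀ from K2, then (m, χ) from K1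
at constant c₀ beyond max(m₀,1); for n = m + e in the window inherit χ to χ' of the same size with
γ_χ'(per) ≠ 0; K2 forces γ_χ'(tr X^m) = 0 (else its degree bound contradicts K1's), so 0 = γ_χ'(tr
X^m) < γ_χ'(per_m). [difficulty: provable-now] -/
@[route_item "route-ValiantsHypothesis-GeneratorObstructions"]
def CruxesToThesis : Prop :=
  PerGenDegreeSuperQP → PowGenDegreeQP → GenInheritance → GenFlipThesis

-- `CruxesToThesis` holds: proved by `Summit.ValiantsHypothesis.ValiantsHypothesis.Theorems.GeneratorObstructions.cruxesToThesis_proof` @ c73224af389e (its module imports this route file, so no `_holds` link can be stated here).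

/-- item stmt-ValiantsHypothesis-11663 · support · rank 9 · closed · moot by None · by planner
sources: GesmundoIkenmeyerPanova2017, Burgisser2024Completeness, arXiv:1604.06431
[support] NEGATIVE SIDE / kill criterion (γ-analogue of GIP17 Thm 10 lifted to orbit CLOSURES and of
GCTMult.GctNoMultBarrier): from some polynomial matrix size n = m + e ≥ m^c₀ on, γ_χ(per_m) ≤ γ_χ(tr
X^m) for every weight χ — no generator obstruction at all. A proof refutes GenFlipThesis (the window
[m, 2^((log₂ m + c)^c)] contains n = m^c₀ once c > c₀) and closes the route. Not known even for
occurrence in the closure setting (GIP17 remark after Thm 10; Burgisser2024Completeness §7.5). Filed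
unranked for refuters. [difficulty: open-problem] -/
@[route_item "route-ValiantsHypothesis-GeneratorObstructions"]
def NoGenFlipBeyondPoly : Prop :=
  ∃ c₀ m₀ : ℕ, ∀ m e : ℕ, m₀ ≤ m → m ^ c₀ ≤ m + e → ∀ χ : Literature.NumberTheory.DiophantineGeometry.Weight (Literature.NumberTheory.DiophantineGeometry.MatIdx (m + e)), Module.finrank ℂ (↥(Literature.NumberTheory.DiophantineGeometry.highestWeightSpace (Literature.Computability.AlgebraicComplexity.orbitCoordRep (MvPolynomial.rename (fun ij : Fin m × Fin m => toLex (Fin.castAdd e ij.1, Fin.castAdd e ij.2)) (Literature.Computability.AlgebraicComplexity.perPoly (Fin m) ℂ)) m) χ) ⧸ Submodule.comap (Literature.NumberTheory.DiophantineGeometry.highestWeightSpace (Literature.Computability.AlgebraicComplexity.orbitCoordRep (MvPolynomial.rename (fun ij : Fin m × Fin m => toLex (Fin.castAdd e ij.1, Fin.castAdd e ij.2)) (Literature.Computability.AlgebraicComplexity.perPoly (Fin m) ℂ)) m) χ).subtype (⨆ p : Literature.NumberTheory.DiophantineGeometry.Weight (Literature.NumberTheory.DiophantineGeometry.MatIdx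 (m + e)) × Literature.NumberTheory.DiophantineGeometry.Weight (Literature.NumberTheory.DiophantineGeometry.MatIdx (m + e)), ⨆ (_ : p.1 + p.2 = χ ∧ p.1 ≠ 0 ∧ p.2 ≠ 0), Literature.NumberTheory.DiophantineGeometry.highestWeightSpace (Literature.Computability.AlgebraicComplexity.orbitCoordRep (MvPolynomial.rename (fun ij : Fin m × Fin m => toLex (Fin.castAdd e ij.1, Fin.castAdd e ij.2)) (Literature.Computability.AlgebraicComplexity.perPoly (Fin m) ℂ)) m) p.1 * Literature.NumberTheory.DiophantineGeometry.highestWeightSpace (Literature.Computability.AlgebraicComplexity.orbitCoordRep (MvPolynomial.rename (fun ij : Fin m × Fin m => toLex (Fin.castAdd e ij.1, Fin.castAdd e ij.2)) (Literature.Computability.AlgebraicComplexity.perPoly (Fin m) ℂ)) m) p.2)) ≤ Module.finrank ℂ (↥(Literature.NumberTheory.DiophantineGeometry.highestWeightSpace (Literature.Computability.AlgebraicComplexity.orbitCoordRep (Literature.NumberTheory.DiophantineGeometry.powFormLex ℂ (m + e) m) m) χ) ⧸ Submodule.comap (Literature.NumberTheory.DiophantineGeometry.highestWeightSpace (Literature.Computability.AlgebraicComplexity.orbitCoordRep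 (Literature.NumberTheory.DiophantineGeometry.powFormLex ℂ (m + e) m) m) χ).subtype (⨆ p : Literature.NumberTheory.DiophantineGeometry.Weight (Literature.NumberTheory.DiophantineGeometry.MatIdx (m + e)) × Literature.NumberTheory.DiophantineGeometry.Weight (Literature.NumberTheory.DiophantineGeometry.MatIdx (m + e)), ⨆ (_ : p.1 + p.2 = χ ∧ p.1 ≠ 0 ∧ p.2 ≠ 0), Literature.NumberTheory.DiophantineGeometry.highestWeightSpace (Literature.Computability.AlgebraicComplexity.orbitCoordRep (Literature.NumberTheory.DiophantineGeometry.powFormLex ℂ (m + e) m) m) p.1 * Literature.NumberTheory.DiophantineGeometry.highestWeightSpace (Literature.Computability.AlgebraicComplexity.orbitCoordRep (Literature.NumberTheory.DiophantineGeometry.powFormLex ℂ (m + e) m) m) p.2))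

/-- item stmt-ValiantsHypothesis-18306 · support · rank 9 · closed · proved by Summit.ValiantsHypothesis.ValiantsHypothesis.Theorems.GeneratorObstructions.genFlipThesisOfSubs_proof (prover) · by planner
sources: DerksenMakam2020, GesmundoIkenmeyerPanova2017
[support] glue of the typed split of the deciding crux (BC2 redirect): K1 → K2 → GenFlipThesis by
DEGREE OVERFLOW through the landed inheritance theorem genInheritance_proof (item 11659) — K2 at c
gives c₀; K1 at c₀ beyond max(m₀,1) gives (m, χ); inherit χ to χ' of the same size with γ_χ'(per_m)
≥ 1; a trace-side generator of type χ' would contradict the degree bounds, so γ_χ'(tr X^m) = 0 <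
γ_χ'(per_m) at every size of the window. = CruxesToThesis (11662, proved) with its GenInheritance
hypothesis discharged. PROVED in the planner folder (theorem genFlipThesis_of_subs, rc0, axioms
propext/Classical.choice/Quot.sound), attached as candidate proof; a prover lands it verbatim with
--workitem <this item>. [deps: PerGenDegreeSuperQP, PowGenDegreeQP, GenInheritance] [difficulty:
provable-now] -/
@[route_item "route-ValiantsHypothesis-GeneratorObstructions"]
def GenFlipThesisOfSubs : Prop :=
  PerGenDegreeSuperQP → PowGenDegreeQP → GenFlipThesis

-- `GenFlipThesisOfSubs` holds: proved by `Summit.ValiantsHypothesis.ValiantsHypothesis.Theorems.GeneratorObstructions.genFlipThesisOfSubs_proof` (its module imports this route file, so no `_holds` link can be stated here).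

/-- item stmt-ValiantsHypothesis-11664 · assembly · rank 1 · closed · proved by Summit.ValiantsHypothesis.ValiantsHypothesis.Theorems.generatorObstructions_assembly_proof @ ecaa587d4153 (prover) · by planner
sources: GesmundoIkenmeyerPanova2017, Valiant1979, Burgisser2000
[assembly] GenFlipThesis → GenPrinciple → PowTraceMembership → PerPowTraceQP → ValiantsHypothesis
(the deciding theorem `closes` has exactly these four hypotheses). -/
@[route_item "route-ValiantsHypothesis-GeneratorObstructions"]
def Assembly : Prop :=
  GenFlipThesis → GenPrinciple → PowTraceMembership → PerPowTraceQP → ValiantsHypothesis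

-- `Assembly` holds: proved by `Summit.ValiantsHypothesis.ValiantsHypothesis.Theorems.generatorObstructions_assembly_proof` @ ecaa587d4153 (its module imports this route file, so no `_holds` link can be stated here).

/-! D-0027 §2.1 — DECIDING THEOREM (planner-authored via `route open/edit --closes-file`; by planner-tenure-valiant-dormant-sweep-g1-0 2026-08-27T17:15:23Z) — ARCHIVED: route closed (refuted) 2026-09-03T21:57:38Z; kept so importers keep building:
its hypotheses are this route's items and its conclusion the sub-problem Statement (glue_lint), and it elaborates with this file. -/

@[closes "route-ValiantsHypothesis-GeneratorObstructions"] theorem closes (hK1 : PerGenDegreeSuperQP) (hK2 : PowGenDegreeQP) (hGlue : GenFlipThesisOfSubs)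
    (hP : GenPrinciple) (hM : PowTraceMembership) (hQ : PerPowTraceQP) : _root_.ValiantsHypothesis := by
  -- BC2 redirect (tenure g1, A2): the deciding crux GenFlipThesis is DERIVED from its typed split
  -- K1 = PerGenDegreeSuperQP and K2 = PowGenDegreeQP through the proved glue item GenFlipThesisOfSubs (stmt-18306).
  have hX : GenFlipThesis := hGlue hK1 hK2
  show Literature.Computability.AlgebraicComplexity.VP ℂ ≠ Literature.Computability.AlgebraicComplexity.VNP ℂ
  intro hEq
  have hper : Literature.Computability.AlgebraicComplexity.perFamily ℂ ∈
      Literature.Computability.AlgebraicComplexity.VP ℂ := by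
    rw [hEq]; exact Literature.Computability.AlgebraicComplexity.perFamily_mem_VNP_holds ℂ
  have hvp : Literature.Computability.AlgebraicComplexity.IsVPFamily
      (fun n => Literature.Computability.AlgebraicComplexity.perPoly (Fin n) ℂ) :=
    (Literature.Computability.AlgebraicComplexity.mem_VP_ofFintype_iff_holds _).1 hper
  obtain ⟨c, hc⟩ := hQ hvp
  obtain ⟨m, -, hm1, hwin⟩ := hX c 0
  obtain ⟨e, hle, hrepr⟩ := hc m hm1
  obtain ⟨χ, hχ⟩ := hwin e hle
  have hmem := hM m e (m + e) hm1 le_rfl hrepr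
  have hle' := hP _ _ m (by omega) hmem χ
  exact absurd hχ (not_lt.mpr hle')

end Summit.ValiantsHypothesis.ValiantsHypothesis.Theses.GeneratorObstructions
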